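import Mathlib
import Summits.Ventures.PercRepro2.HCov
import Summits.Ventures.PercRepro2.A3Inactive
import Summits.Ventures.PercRepro2.DiagBA3
import Summits.Ventures.PercRepro2.CPolarA3Marks
import Summits.Ventures.PercRepro2.CPolarSubPlus

/-!
# (HCOV⁺) ON THE DIAGONALS `b = a₃` AND `o = a₃` (blind cell PercRepro2, p5 g16;
`proofs/P5-OEDGE.md` §22, the diagonal clause)

The attachment vertex of a pendant `a₃`-cluster may be a mark, and then the identified instance of
`QuarticPendant.hcovPlus_of_pendant` is a diagonal. Both diagonals satisfy (HCOV⁺) for every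
weighted graph:

* `b = a₃`: with `L = P(T′) = P(Q, bL)`, `H = P(T) = P(Q, bH)`, `D = P(PD)`, the slack collapses to
  `slackB = 4·L·H` (`Q = D + L + H` under `Q`, `EQb3 = L + H`, `EQ3 = L − H`, `gap = H − L`, `PDb = 0`),
  `Gc(b = a₃) = 2(D + 2H)M₂ + 2(D + 2L)M₁` (DiagBA3.lean) and the whole form factors as
  **`Q·Gc + covU·slackB = 2QD(M₁ + M₂) + 4D·[H·(L·oH − Q·T′H) + L·(H·oL − Q·TL)]`**
  (**`hcovPlus_diag_b_identity`**), whose four brackets are mine-2's two cross-cluster blocks and the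
  two BHK 1.4 inequalities `A3Inactive.bLoH_mul_Q_le` / `bHoL_mul_Q_le` — **`hcovPlus_diag_b`**;
* `o = a₃`: `Gc = 0` (`CPolarA3.Gc_eq_zero_of_o_joined` with `o = a₃`), `covU = P(Q, a₃ ∈ U)·D ≥ 0`
  (`= Q²·Var_ν(U_{a₃})`) and `slackB ≥ 0` —
  **`hcovPlus_diag_o`**.

So `HCovPlus_all` (ten distinctness binders) closes the whole pendant face of `CPolarA3Sub_all`:
an attachment at an unmarked vertex by `CPolarSubPlus.sub_of_pendant_of_hcovPlus`, at `b` or `o`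
by the same theorem with the diagonal (HCOV⁺) proved here, at a root as a reach-root edge.
-/

namespace Summit.Ventures.PercRepro2

open UnionCluster CovForm PendantA3 DiagBA3 CPolarSubPlus

namespace HCovPlusDiag

section DiagB

variable {V : Type*} {E : Type*} [Fintype V] [DecidableEq V] [Fintype E] [DecidableEq E]
  {R : Type*} [Field R] [LinearOrder R] [IsStrictOrderedRing R]

variable {ends : E → Sym2 V}

omit [Fintype V] in
/-- **The diagonal identity for (HCOV⁺)**: on `b = a₃`,
`Q·Gc + covU·slackB = 2QD(M₁ + M₂) + 4D·[P(T)·(P(T′)·P(Q, oH) − Q·P(T′, oH)) + P(T′)·(P(T)·P(Q, oL) − Q·P(T, oL))]`. -/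
theorem hcovPlus_diag_b_identity (p : E → R) (o a₁ a₂ b : V) :
    prob p (avoidAll ends a₂ {a₁}) * Gc p ends o a₁ a₂ b b +
        covU p ends o a₁ a₂ b * slackB p ends a₁ a₂ b b =
      2 * prob p (avoidAll ends a₂ {a₁}) * prob p (PDEvent ends a₁ a₂ b) *
          ((prob p (TEvent ends a₁ a₂ b) * prob p (PDEvent ends a₁ a₂ b ∩ connEvent ends a₁ o) -
              prob p (PDEvent ends a₁ a₂ b) * prob p (TEvent ends a₁ a₂ b ∩ connEvent ends a₁ o)) +
            (prob p (TEvent ends a₂ a₁ b) * prob p (PDEvent ends a₁ a₂ b ∩ connEvent ends a₂ o) -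
              prob p (PDEvent ends a₁ a₂ b) * prob p (TEvent ends a₂ a₁ b ∩ connEvent ends a₂ o))) +
        4 * prob p (PDEvent ends a₁ a₂ b) *
          (prob p (TEvent ends a₁ a₂ b) *
              (prob p (TEvent ends a₂ a₁ b) * prob p (avoidAll ends a₂ {a₁} ∩ connEvent ends a₂ o) -
                prob p (avoidAll ends a₂ {a₁}) * prob p (TEvent ends a₂ a₁ b ∩ connEvent ends a₂ o)) +
            prob p (TEvent ends a₂ a₁ b) *
              (prob p (TEvent ends a₁ a₂ b) * prob p (avoidAll ends a₂ {a₁} ∩ connEvent ends a₁ o) -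
                prob p (avoidAll ends a₂ {a₁}) * prob p (TEvent ends a₁ a₂ b ∩ connEvent ends a₁ o))) := by
  have hT'13 : ∀ ω ∈ TEvent ends a₂ a₁ b, Conn ends ω a₁ b := fun _ h => h.2
  have hT'23 : ∀ ω ∈ TEvent ends a₂ a₁ b, ¬ Conn ends ω a₂ b :=
    fun _ h h23 => h.1 (conn_trans h.2 (conn_symm h23))
  have hT23 : ∀ ω ∈ TEvent ends a₁ a₂ b, Conn ends ω a₂ b := fun _ h => h.2
  have hT13 : ∀ ω ∈ TEvent ends a₁ a₂ b, ¬ Conn ends ω a₁ b :=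
    fun _ h h13 => h.1 (conn_trans h.2 (conn_symm h13))
  have hPD13 : ∀ ω ∈ PDEvent ends a₁ a₂ b, ¬ Conn ends ω a₁ b :=
    fun _ h h13 => h.2 (Or.inl (conn_symm h13))
  have hPD23 : ∀ ω ∈ PDEvent ends a₁ a₂ b, ¬ Conn ends ω a₂ b :=
    fun _ h h23 => h.2 (Or.inr (conn_symm h23))
  have hsplit := Qsplit_univ p ends a₁ a₂ b
  rw [Gc_diag3_eq]
  unfold covU slackB EQb3 EQ3 PDb Do
  rw [gap_eq_Q]
  simp only [Q_inter_conn13 ends a₁ a₂ b, Q_inter_conn23 ends a₁ a₂ b,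
    inter_conn_eq_self hT'13, inter_conn_eq_empty hT'23, inter_conn_eq_self hT23,
    inter_conn_eq_empty hT13, inter_conn_eq_empty hPD13, inter_conn_eq_empty hPD23, prob_empty]
  linear_combination
    (((prob p (avoidAll ends a₂ {a₁} ∩ connEvent ends a₁ o) +
        prob p (avoidAll ends a₂ {a₁} ∩ connEvent ends a₂ o)) * prob p (PDEvent ends a₁ a₂ b) -
      prob p (avoidAll ends a₂ {a₁}) *
        (prob p (PDEvent ends a₁ a₂ b ∩ connEvent ends a₁ o) +
          prob p (PDEvent ends a₁ a₂ b ∩ connEvent ends a₂ o))) *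
      (prob p (TEvent ends a₂ a₁ b) + prob p (TEvent ends a₁ a₂ b))) * hsplit

/-- **(HCOV⁺) on the diagonal `b = a₃`**, for every weighted graph and all vertices. -/
theorem hcovPlus_diag_b (p : E → R) (hp : IsProbVec p) (o a₁ a₂ b : V) :
    HCovPlus p ends o a₁ a₂ b b := by
  unfold HCovPlus
  rw [hcovPlus_diag_b_identity]
  have hQ := prob_nonneg hp (avoidAll ends a₂ {a₁})
  have hD := prob_nonneg hp (PDEvent ends a₁ a₂ b)
  have hT := prob_nonneg hp (TEvent ends a₁ a₂ b)
  have hT' := prob_nonneg hp (TEvent ends a₂ a₁ b)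
  -- the two cross-cluster blocks of the diagonal
  have hM1 := ToL_mul_D_le p hp ends o a₁ a₂ b
  have hM2 := T'oH_mul_D_le p hp ends o a₁ a₂ b
  -- the two BHK 1.4 inequalities, with `Q ∩ {a₁ ↔ b} = T′`, `Q ∩ {a₂ ↔ b} = T`
  have hB1 := A3Inactive.bLoH_mul_Q_le p hp ends o a₁ a₂ b
  have hB2 := A3Inactive.bHoL_mul_Q_le p hp ends o a₁ a₂ b
  rw [Q_inter_inter_conn13 ends a₁ a₂ b, Q_inter_conn13 ends a₁ a₂ b] at hB1
  rw [Q_inter_inter_conn23 ends a₁ a₂ b, Q_inter_conn23 ends a₁ a₂ b] at hB2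
  refine add_nonneg (mul_nonneg (mul_nonneg (mul_nonneg (by norm_num) hQ) hD) ?_)
    (mul_nonneg (mul_nonneg (by norm_num) hD) ?_)
  · exact add_nonneg (by linarith) (by linarith)
  · exact add_nonneg (mul_nonneg hT (by linarith)) (mul_nonneg hT' (by linarith))

end DiagB

section DiagO

variable {V : Type*} {E : Type*} [Fintype V] [DecidableEq V] [Fintype E] [DecidableEq E]
  {R : Type*} [Field R] [LinearOrder R] [IsStrictOrderedRing R]

variable {ends : E → Sym2 V}

omit [Fintype V] [DecidableEq V] [Fintype E] [DecidableEq E] [LinearOrder R] [IsStrictOrderedRing R] in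
/-- `PD ∩ {a₃ ∈ U}` is empty. -/
lemma PD_inter_conn_eq_empty (a₁ a₂ a₃ : V) (Y : Set (Config E)) :
    PDEvent ends a₁ a₂ a₃ ∩ (Y ∩ connEvent ends a₁ a₃) = ∅ ∧
      PDEvent ends a₁ a₂ a₃ ∩ (Y ∩ connEvent ends a₂ a₃) = ∅ ∧
      PDEvent ends a₁ a₂ a₃ ∩ connEvent ends a₁ a₃ = ∅ ∧
      PDEvent ends a₁ a₂ a₃ ∩ connEvent ends a₂ a₃ = ∅ := by
  have hPD13 : ∀ ω ∈ PDEvent ends a₁ a₂ a₃, ¬ Conn ends ω a₁ a₃ :=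
    fun _ h h13 => h.2 (Or.inl (conn_symm h13))
  have hPD23 : ∀ ω ∈ PDEvent ends a₁ a₂ a₃, ¬ Conn ends ω a₂ a₃ :=
    fun _ h h23 => h.2 (Or.inr (conn_symm h23))
  exact ⟨inter_inter_conn_eq_empty hPD13, inter_inter_conn_eq_empty hPD23,
    inter_conn_eq_empty hPD13, inter_conn_eq_empty hPD23⟩

omit [Fintype V] [DecidableEq V] in
/-- **`Gc` vanishes on the diagonal `o = a₃`** (`CPolarA3.Gc_eq_zero_of_o_joined` with `o = a₃`). -/
theorem Gc_diag_o_eq_zero (p : E → R) (a₁ a₂ a₃ b : V) : Gc p ends a₃ a₁ a₂ a₃ b = 0 :=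
  CPolarA3.Gc_eq_zero_of_o_joined (p := p) (ends := ends) fun ω _ => conn_refl ends ω a₃

/-- **(HCOV⁺) on the diagonal `o = a₃`**: `Gc = 0`, `covU = Q²·Var_ν(U_{a₃}) ≥ 0`, `slackB ≥ 0`. -/
theorem hcovPlus_diag_o (p : E → R) (hp : IsProbVec p) (a₁ a₂ a₃ b : V) :
    HCovPlus p ends a₃ a₁ a₂ a₃ b := by
  unfold HCovPlus
  rw [Gc_diag_o_eq_zero, mul_zero, zero_add]
  refine mul_nonneg ?_ (slack_nonneg p hp ends a₁ a₂ a₃ b)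
  -- `covU = (P(Q, a₃ ∈ U))·D − Q·P(PD, a₃ ∈ U) = P(Q, a₃ ∈ U)·D ≥ 0`
  unfold covU Do
  obtain ⟨-, -, hP3, hP4⟩ := PD_inter_conn_eq_empty (ends := ends) a₁ a₂ a₃ (Set.univ)
  rw [hP3, hP4, prob_empty, add_zero, mul_zero, sub_zero]
  exact mul_nonneg (add_nonneg (prob_nonneg hp _) (prob_nonneg hp _)) (prob_nonneg hp _)

end DiagO

end HCovPlusDiag

end Summit.Ventures.PercRepro2
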